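/-
Copyright: width seat `ym-line-sll-p2` (prover-ym-line-sll-p2-g2-0), route `SoftLoopLongLag`, crux T′ `ColdBoxSoftLoopLagFloor`
(stmt-QuantumFields-24180), line `birth`, registered stub E1a `stub_innerFlatLagFloorG`, brick 6.
-/
import Summits.QuantumFields.YangMills.Theorems.SoftLoopLongLagInnerFlatLoopCore
import Summits.QuantumFields.YangMills.Theorems.SoftLoopLongLagLoopTranslation
import Summits.QuantumFields.YangMills.Theorems.SoftLoopLongLagInductanceBounds
import Summits.QuantumFields.YangMills.Theorems.ColdBoxAllGroupsDefs

/-!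
# Route `SoftLoopLongLag`, crux T′, stub E1a, brick E1a-6 «Reduction»: from the loop core to the flat inner lag covariance at fixed `β`

At fixed `β` and with every window quantity explicit, the lag-`R` autocovariance of the translated soft-loop observable
`F_H = softLoopObs r R ∘ configShift (−c)`, `c = boxCentre H`, in the cold-wall box state `boxState r.ρ β H` is bounded below by the
Wick floor:

**`beta_sq_lagCov_flat_ge`**:
`N⁻²·((D/2)·wickLagSum R R − [(D/2)·2δ·C_M·#C² + ERR + 6(2βN·#C)²·q]) ≤ β²·lagCov (boxState r.ρ β H) F_H R`,
`C = timeZeroCube R`, where `ERR` is the right-hand side of the core `abs_loopCov_cond_sub_gauss_le_coreG` (brick E1a-5), `q` bounds the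
`boxState`-mass of the large-field event, `δ = K_D R⁴/H⁴` is the Dirichlet-vs-free inductance error (sll-p4's
`exists_abs_dirInductance_sub_mutualInductance_le`, hypothesis `hKD`) and `Σ|M| ≤ C_M #C²` (lead's `sum_sum_abs_mutualInductance_lag_le`,
hypothesis `hCM`).  Steps: (1) loop by loop `F_H = #C·N⁻¹N − (βN)⁻¹ f` with `f = Σ_z β·cost_{z+c}` (`softLoopObs_configShift_neg`,
`…_timeShiftLG`), so `β²·lagCov = N⁻²·Cov(f, g)` (`cov_const_sub_mul`); (2) conditioning on `coldGoodSetG` costs `6(2βN#C)²·q`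
(`abs_cov_sub_cov_cond_le`); (3) the core; (4) `Σ M_D² ≥ wickLagSum − 2δΣ|M|` (`sq_ge_sq_sub`, `mutualInductance_shift`).
No sorry; no new definition; standard axioms.  HONEST LABEL: rung R2xi-G RECORD label (leaf `WeakCouplingRates.XiPow`, an UPPER bound on
the lattice mass gap); NOT the Clay mass gap; no summit statement is touched.
-/

set_option autoImplicit false

noncomputable section

open MeasureTheory ProbabilityTheory Finset Real
open Literature.Probability.LatticeModels (Site zdGraph)
open Literature.MathematicalPhysics.QuantumLattice
open Literature.MathematicalPhysics.QuantumFieldTheory (LatticeRep)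
open Literature.MathematicalPhysics.QuantumFieldTheory.LatticeMaxwell
open Literature.MathematicalPhysics.QuantumFieldTheory.AxialGauge
open Summit.QuantumFields.YangMills.Theorems.WeakCouplingRates
open Summit.QuantumFields.YangMills.Theorems.FreeEnergyLogCoefficient
open Summit.QuantumFields.YangMills.Theorems.ColdBoxAllGroups (cfgTE unscaleTE TSpaceD gaussD goodTE tiltWE coldGoodSetG
  measurableSet_coldGoodSetG)

namespace Summit.QuantumFields.YangMills.Theorems.SoftLoopLongLag

/-! ## Elementary pieces -/

/-- Covariance of affine images: `Cov(a − b·f, a − b·g) = b²·Cov(f, g)` (probability measure, `f, g, fg` integrable). -/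
theorem cov_const_sub_mul {Ω : Type*} [MeasurableSpace Ω] (μ : Measure Ω) [IsProbabilityMeasure μ] (a b : ℝ) {f g : Ω → ℝ}
    (hf : Integrable f μ) (hg : Integrable g μ) (hfg : Integrable (fun ω => f ω * g ω) μ) :
    (∫ ω, (a - b * f ω) * (a - b * g ω) ∂μ) - (∫ ω, (a - b * f ω) ∂μ) * (∫ ω, (a - b * g ω) ∂μ) =
      b ^ 2 * ((∫ ω, f ω * g ω ∂μ) - (∫ ω, f ω ∂μ) * (∫ ω, g ω ∂μ)) := by
  have e1 : ∀ ω, (a - b * f ω) * (a - b * g ω) = a ^ 2 - a * b * g ω - a * b * f ω + b ^ 2 * (f ω * g ω) := fun ω => by ring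
  simp_rw [e1]
  have h1 : Integrable (fun _ : Ω => a ^ 2) μ := integrable_const _
  have h2 : Integrable (fun ω => a * b * g ω) μ := hg.const_mul _
  have h3 : Integrable (fun ω => a * b * f ω) μ := hf.const_mul _
  have h4 : Integrable (fun ω => b ^ 2 * (f ω * g ω)) μ := hfg.const_mul _
  have h12 : Integrable (fun ω => a ^ 2 - a * b * g ω) μ := h1.sub h2
  have h123 : Integrable (fun ω => a ^ 2 - a * b * g ω - a * b * f ω) μ := h12.sub h3
  have hbf : Integrable (fun ω => b * f ω) μ := hf.const_mul _
  have hbg : Integrable (fun ω => b * g ω) μ := hg.const_mul _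
  have ha : Integrable (fun _ : Ω => a) μ := integrable_const _
  rw [integral_add h123 h4, integral_sub h12 h3, integral_sub h1 h2, integral_sub ha hbf, integral_sub ha hbg]
  simp only [integral_const, integral_const_mul, probReal_univ, smul_eq_mul, one_mul]
  ring

/-- `a² ≥ b² − 2|b|·|a − b|` for reals. -/
theorem sq_ge_sq_sub (a b : ℝ) : b ^ 2 - 2 * |b| * |a - b| ≤ a ^ 2 := by
  have h : a ^ 2 - b ^ 2 = (a - b) ^ 2 + 2 * b * (a - b) := by ring
  have h2 : -(2 * |b| * |a - b|) ≤ 2 * b * (a - b) := by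
    rw [show 2 * |b| * |a - b| = 2 * |b * (a - b)| by rw [abs_mul]; ring]
    linarith [neg_abs_le (b * (a - b))]
  nlinarith [sq_nonneg (a - b)]

variable {G : Type} [Group G] [TopologicalSpace G]

/-- A rectangle Wilson loop with the normalised character, written through the loop cost:
`W_ℓ(U) = N⁻¹·N − N⁻¹·(N − Re tr r(hol_ℓ U))`. -/
theorem wilsonLoopObs_eq_const_sub_cost (r : LatticeRep G) (y : Site 4) (R : ℕ) (U : LGConfig 4 G) :
    wilsonLoopObs (fun g : G => (r.N : ℝ)⁻¹ * (r.ρ g).trace.re) (rectWalk y 1 2 R R) U =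
      (r.N : ℝ)⁻¹ * r.N - (r.N : ℝ)⁻¹ * ((r.N : ℝ) - (r.ρ (walkHolonomy U (rectWalk y 1 2 R R))).trace.re) := by
  unfold wilsonLoopObs
  ring

section Shift

variable [MeasurableSpace G]

/-- **The translated soft-loop observable through the scaled loop-cost sum**: for `β ≠ 0`,
`softLoopObs r R (configShift (−c) U) = #C·N⁻¹N − (βN)⁻¹ · Σ_{z∈C} β·cost_{z+c}(U)`, `C = timeZeroCube R`. -/
theorem softLoopObs_configShift_neg_eq_cost (r : LatticeRep G) (R : ℕ) (c : Site 4) {β : ℝ} (hβ : β ≠ 0) (U : LGConfig 4 G) :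
    softLoopObs r R (configShift (-c) U) =
      (timeZeroCube R).card * ((r.N : ℝ)⁻¹ * r.N) - (β * r.N)⁻¹ *
        ∑ z ∈ timeZeroCube R, β * ((r.N : ℝ) - (r.ρ (walkHolonomy U (rectWalk (z + c) 1 2 R R))).trace.re) := by
  rw [softLoopObs_configShift_neg]
  simp_rw [wilsonLoopObs_eq_const_sub_cost]
  rw [Finset.sum_sub_distrib, Finset.sum_const, nsmul_eq_mul]
  simp only [Finset.mul_sum]
  congr 1
  refine Finset.sum_congr rfl fun z _ => ?_
  field_simp

/-- The same for the time-shifted observable: loops at `z + (c + R e₀)`. -/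
theorem softLoopObs_configShift_neg_timeShiftLG_eq_cost (r : LatticeRep G) (R : ℕ) (c : Site 4) {β : ℝ} (hβ : β ≠ 0) (U : LGConfig 4 G) :
    softLoopObs r R (configShift (-c) (timeShiftLG (G := G) R U)) =
      (timeZeroCube R).card * ((r.N : ℝ)⁻¹ * r.N) - (β * r.N)⁻¹ *
        ∑ z ∈ timeZeroCube R, β * ((r.N : ℝ) - (r.ρ (walkHolonomy U (rectWalk (z + (c + Pi.single 0 (R : ℤ))) 1 2 R R))).trace.re) := by
  rw [softLoopObs_configShift_neg_timeShiftLG]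
  have hz : ∀ z : Site 4, wilsonLoopObs (fun g : G => (r.N : ℝ)⁻¹ * (r.ρ g).trace.re) (rectWalk (z + c + Pi.single 0 (R : ℤ)) 1 2 R R) U =
      (r.N : ℝ)⁻¹ * r.N - (r.N : ℝ)⁻¹ *
        ((r.N : ℝ) - (r.ρ (walkHolonomy U (rectWalk (z + (c + Pi.single 0 (R : ℤ))) 1 2 R R))).trace.re) := fun z => by
    rw [wilsonLoopObs_eq_const_sub_cost, add_assoc]
  rw [Finset.sum_congr rfl fun z _ => hz z, Finset.sum_sub_distrib, Finset.sum_const, nsmul_eq_mul]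
  simp only [Finset.mul_sum]
  congr 1
  refine Finset.sum_congr rfl fun z _ => ?_
  field_simp

end Shift

variable [IsTopologicalGroup G] [CompactSpace G]

/-- The scaled loop-cost sum is bounded: `|Σ_{z∈C} β·cost_{z+u}(U)| ≤ #C·(β·2N)` (`β ≥ 0`). -/
theorem abs_sum_beta_mul_loopCost_le (r : LatticeRep G) (R : ℕ) (u : Site 4) {β : ℝ} (hβ : 0 ≤ β) (U : LGConfig 4 G) :
    |∑ z ∈ timeZeroCube R, β * ((r.N : ℝ) - (r.ρ (walkHolonomy U (rectWalk (z + u) 1 2 R R))).trace.re)| ≤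
      (timeZeroCube R).card * (β * (2 * r.N)) := by
  refine (Finset.abs_sum_le_sum_abs _ _).trans ?_
  calc ∑ z ∈ timeZeroCube R, |β * ((r.N : ℝ) - (r.ρ (walkHolonomy U (rectWalk (z + u) 1 2 R R))).trace.re)|
      ≤ ∑ _z ∈ timeZeroCube R, β * (2 * r.N) := Finset.sum_le_sum fun z _ => by
        rw [abs_mul, abs_of_nonneg hβ]
        exact mul_le_mul_of_nonneg_left (abs_loopCost_le r.ρ r.continuous (rectWalk (z + u) 1 2 R R) U) hβ
    _ = _ := by rw [Finset.sum_const, nsmul_eq_mul]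

variable [MeasurableSpace G] [BorelSpace G]

omit [CompactSpace G] in
/-- The scaled loop-cost sum is measurable. -/
theorem measurable_sum_beta_mul_loopCost [SecondCountableTopology G] (r : LatticeRep G) (R : ℕ) (u : Site 4) (β : ℝ) :
    Measurable fun U : LGConfig 4 G =>
      ∑ z ∈ timeZeroCube R, β * ((r.N : ℝ) - (r.ρ (walkHolonomy U (rectWalk (z + u) 1 2 R R))).trace.re) :=
  Finset.measurable_sum _ fun z _ => measurable_loopCost r.ρ r.continuous β (rectWalk (z + u) 1 2 R R)

/-! ## The Wick floor in Dirichlet dress -/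

/-- **The Dirichlet mutual inductances of the translated loops dominate the Wick floor up to the near-centre correction**:
if `|M_D(z+c, z'+(c+Re₀)) − M(z, z'+Re₀)| ≤ δ` for all `z, z' ∈ C` and `Σ_{z,z'}|M(z, z'+Re₀)| ≤ S`, then
`wickLagSum R R − 2δS ≤ Σ_{z,z'∈C} M_D(z+c, z'+(c+Re₀))²`. -/
theorem wickLagSum_sub_le_sum_dirInductance_sq (H R : ℕ) (c : Site 4) {δ S : ℝ} (hδ : 0 ≤ δ)
    (hD : ∀ z ∈ timeZeroCube R, ∀ z' ∈ timeZeroCube R,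
      |(∑ p ∈ rectSurface (z + c) R R, ∑ q ∈ rectSurface (z' + (c + Pi.single 0 (R : ℤ))) R R,
          boxDirProjKernel H (p.1, p.2.1.1, p.2.1.2) (q.1, q.2.1.1, q.2.1.2)) -
        mutualInductance z (z' + Pi.single 0 (R : ℤ)) R| ≤ δ)
    (hS : ∑ z ∈ timeZeroCube R, ∑ z' ∈ timeZeroCube R, |mutualInductance z (z' + Pi.single 0 (R : ℤ)) R| ≤ S) :
    wickLagSum R R - 2 * δ * S ≤ ∑ z ∈ timeZeroCube R, ∑ z' ∈ timeZeroCube R,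
      (∑ p ∈ rectSurface (z + c) R R, ∑ q ∈ rectSurface (z' + (c + Pi.single 0 (R : ℤ))) R R,
        boxDirProjKernel H (p.1, p.2.1.1, p.2.1.2) (q.1, q.2.1.1, q.2.1.2)) ^ 2 := by
  unfold wickLagSum
  have hpt : ∀ z ∈ timeZeroCube R, ∀ z' ∈ timeZeroCube R,
      mutualInductance z (z' + Pi.single 0 (R : ℤ)) R ^ 2 - 2 * δ * |mutualInductance z (z' + Pi.single 0 (R : ℤ)) R| ≤
        (∑ p ∈ rectSurface (z + c) R R, ∑ q ∈ rectSurface (z' + (c + Pi.single 0 (R : ℤ))) R R,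
          boxDirProjKernel H (p.1, p.2.1.1, p.2.1.2) (q.1, q.2.1.1, q.2.1.2)) ^ 2 := by
    intro z hz z' hz'
    have h1 := sq_ge_sq_sub (∑ p ∈ rectSurface (z + c) R R, ∑ q ∈ rectSurface (z' + (c + Pi.single 0 (R : ℤ))) R R,
      boxDirProjKernel H (p.1, p.2.1.1, p.2.1.2) (q.1, q.2.1.1, q.2.1.2)) (mutualInductance z (z' + Pi.single 0 (R : ℤ)) R)
    have h2 := hD z hz z' hz'
    have h3 : 2 * |mutualInductance z (z' + Pi.single 0 (R : ℤ)) R| *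
        |(∑ p ∈ rectSurface (z + c) R R, ∑ q ∈ rectSurface (z' + (c + Pi.single 0 (R : ℤ))) R R,
            boxDirProjKernel H (p.1, p.2.1.1, p.2.1.2) (q.1, q.2.1.1, q.2.1.2)) -
          mutualInductance z (z' + Pi.single 0 (R : ℤ)) R| ≤ 2 * |mutualInductance z (z' + Pi.single 0 (R : ℤ)) R| * δ :=
      mul_le_mul_of_nonneg_left h2 (by positivity)
    nlinarith
  calc (∑ z ∈ timeZeroCube R, ∑ z' ∈ timeZeroCube R, mutualInductance z (z' + Pi.single 0 (R : ℤ)) R ^ 2) - 2 * δ * S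
      ≤ (∑ z ∈ timeZeroCube R, ∑ z' ∈ timeZeroCube R, mutualInductance z (z' + Pi.single 0 (R : ℤ)) R ^ 2) -
          2 * δ * ∑ z ∈ timeZeroCube R, ∑ z' ∈ timeZeroCube R, |mutualInductance z (z' + Pi.single 0 (R : ℤ)) R| := by
        nlinarith
    _ = ∑ z ∈ timeZeroCube R, ∑ z' ∈ timeZeroCube R,
          (mutualInductance z (z' + Pi.single 0 (R : ℤ)) R ^ 2 - 2 * δ * |mutualInductance z (z' + Pi.single 0 (R : ℤ)) R|) := by
        rw [Finset.mul_sum, ← Finset.sum_sub_distrib]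
        refine Finset.sum_congr rfl fun z _ => ?_
        rw [Finset.mul_sum, ← Finset.sum_sub_distrib]
    _ ≤ _ := Finset.sum_le_sum fun z hz => Finset.sum_le_sum fun z' hz' => hpt z hz z' hz'

/-! ## The reduction at fixed `β` -/

set_option maxHeartbeats 800000 in
/-- **Brick E1a-6: the flat inner lag covariance from the loop core, at fixed `β`** (see the module docstring). -/
theorem beta_sq_lagCov_flat_ge [SecondCountableTopology G] (r : LatticeRep G) {β ε m ℓ Rw p q K_D C_M : ℝ} {H R : ℕ}
    {g : EuclideanSpace ℝ (Fin (dimE r.ρ)) → ℝ} (hgm : Measurable g)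
    (hβ : 1 ≤ β) (hH : 1 ≤ H) (hm0 : 0 ≤ m) (hm4 : m ≤ 1 / 4) (hℓ : 0 ≤ ℓ)
    (hg : ∀ a, ‖a‖ ≤ m → |Real.log (g a)| ≤ ℓ) (hRw : 0 ≤ Rw) (hRm : 4 * (R : ℝ) * m ≤ 1 / 4)
    (hmE : Real.sqrt (dimE r.ρ) * ((12 * (H : ℝ) ^ 2 + 2 * H + 1) * Rw) / Real.sqrt β ≤ 1 / 4)
    (hmEm : Real.sqrt (dimE r.ρ) * ((12 * (H : ℝ) ^ 2 + 2 * H + 1) * Rw) / Real.sqrt β ≤ m)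
    (hwin : (dimE r.ρ : ℝ) / 2 * Rw ^ 2 / β +
      190 * (Real.sqrt (dimE r.ρ) * ((12 * (H : ℝ) ^ 2 + 2 * H + 1) * Rw) / Real.sqrt β) ^ 3 < β ^ (2 * ε - 1))
    (hp : 240 * (dimE r.ρ) * (2 * (H : ℝ) + 1) ^ 4 * Real.exp (-Rw ^ 2 / 2) ≤ p) (hp1 : p < 1)
    (hrep : ∀ X : LGConfig 4 G → ℝ, Measurable X → IsZdGaugeInvariant X → (∀ U, 0 ≤ X U) →
      ∫ U, X U ∂((boxState r.ρ β H)[|coldGoodSetG r.ρ H β ε]) =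
        ∫ t, X (cfgTE r.ρ H β t) ∂(((gaussD H (dimE r.ρ))[|(goodTE r.ρ H β ε ∩
          {t | ∀ e, ‖unscaleTE H (dimE r.ρ) β t e‖ ≤ m})]).tilted
          ((goodTE r.ρ H β ε ∩ {t | ∀ e, ‖unscaleTE H (dimE r.ρ) β t e‖ ≤ m}).indicator (tiltWE r.ρ H g β))))
    (hG0 : boxState r.ρ β H (coldGoodSetG r.ρ H β ε) ≠ 0)
    (hq : (boxState r.ρ β H).real (coldGoodSetG r.ρ H β ε)ᶜ ≤ q)
    (hKD0 : 0 ≤ K_D) (h24 : 24 * (R : ℝ) ≤ H)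
    (hKD : ∀ x y : Site 4, (∀ p ∈ rectSurface x R R, ‖p.1 - boxCentre H‖ ≤ (H : ℝ) / 8) →
      (∀ q ∈ rectSurface y R R, ‖q.1 - boxCentre H‖ ≤ (H : ℝ) / 8) →
      |(∑ p ∈ rectSurface x R R, ∑ q ∈ rectSurface y R R,
          boxDirProjKernel H (p.1, p.2.1.1, p.2.1.2) (q.1, q.2.1.1, q.2.1.2)) - mutualInductance x y R| ≤
        K_D * (R : ℝ) ^ 4 / (H : ℝ) ^ 4)
    (hCM : ∑ z ∈ timeZeroCube R, ∑ z' ∈ timeZeroCube R, |mutualInductance z (z' + Pi.single 0 (R : ℤ)) R| ≤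
      C_M * ((timeZeroCube R).card : ℝ) ^ 2) :
    ((r.N : ℝ) ^ 2)⁻¹ * ((dimE r.ρ : ℝ) / 2 * wickLagSum R R -
        ((dimE r.ρ : ℝ) / 2 * (2 * (K_D * (R : ℝ) ^ 4 / (H : ℝ) ^ 4) * (C_M * ((timeZeroCube R).card : ℝ) ^ 2)) +
          ((3 * ((timeZeroCube R).card * (β * (4 * R * m) ^ 2 / 2 + 9 * β * (4 * R * m) ^ 3)) ^ 2 *
              (Real.exp (2 * ((#(plaquettesTouching (boxEdges 4 (2 * H + 1))) : ℝ) * (190 * β * m ^ 3) +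
                (Fintype.card (ColdFreeIdx H) : ℝ) * ℓ)) - 1) +
            6 * ((timeZeroCube R).card * (β * (4 * R * m) ^ 2 / 2 + 9 * β * (4 * R * m) ^ 3)) ^ 2 * p +
            2 * ((timeZeroCube R).card * (9 * β * (4 * R * m) ^ 3)) *
              ((timeZeroCube R).card * (β * (4 * R * m) ^ 2 / 2 + 9 * β * (4 * R * m) ^ 3) +
                dimE r.ρ * (timeZeroCube R).card * (R : ℝ) ^ 4) +
            Real.sqrt p * (2 * ((timeZeroCube R).card * (β * (4 * R * m) ^ 2 / 2 + 9 * β * (4 * R * m) ^ 3)) *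
              (dimE r.ρ * (timeZeroCube R).card * (R : ℝ) ^ 4) +
              3 * (dimE r.ρ * (timeZeroCube R).card * (R : ℝ) ^ 4) ^ 2 + (dimE r.ρ * (timeZeroCube R).card * (R : ℝ) ^ 4) ^ 2)) +
            6 * ((timeZeroCube R).card * (β * (2 * r.N))) * ((timeZeroCube R).card * (β * (2 * r.N))) * q))) ≤
      β ^ 2 * lagCov (boxState r.ρ β H) (fun U => softLoopObs r R (configShift (-(boxCentre H)) U)) R := by
  have hβ0 : 0 < β := by linarith
  have hβne : β ≠ 0 := hβ0.ne'
  haveI : IsProbabilityMeasure (boxState r.ρ β H) := isProbabilityMeasure_ymSpecification r.ρ r.continuous β _ _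
  -- the two scaled loop-cost sums: measurability, bounds, integrability
  have hfm := measurable_sum_beta_mul_loopCost r R (boxCentre H) β
  have hgm2 := measurable_sum_beta_mul_loopCost r R (boxCentre H + Pi.single 0 (R : ℤ)) β
  have hfb := fun U => abs_sum_beta_mul_loopCost_le r R (boxCentre H) hβ0.le U
  have hgb := fun U => abs_sum_beta_mul_loopCost_le r R (boxCentre H + Pi.single 0 (R : ℤ)) hβ0.le U
  have hfI := integrable_of_abs_le (γ := boxState r.ρ β H) hfm.aestronglyMeasurable hfb
  have hgI := integrable_of_abs_le (γ := boxState r.ρ β H) hgm2.aestronglyMeasurable hgb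
  have hfgI : Integrable (fun U : LGConfig 4 G =>
      (∑ z ∈ timeZeroCube R, β * ((r.N : ℝ) - (r.ρ (walkHolonomy U (rectWalk (z + boxCentre H) 1 2 R R))).trace.re)) *
        (∑ z ∈ timeZeroCube R, β * ((r.N : ℝ) -
          (r.ρ (walkHolonomy U (rectWalk (z + (boxCentre H + Pi.single 0 (R : ℤ))) 1 2 R R))).trace.re)))
      (boxState r.ρ β H) := by
    refine integrable_of_abs_le (hfm.mul hgm2).aestronglyMeasurable
      (C := (timeZeroCube R).card * (β * (2 * r.N)) * ((timeZeroCube R).card * (β * (2 * r.N)))) fun U => ?_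
    rw [abs_mul]
    exact mul_le_mul (hfb U) (hgb U) (abs_nonneg _) ((abs_nonneg _).trans (hfb U))
  -- step 1: the lag covariance is `(βN)⁻²·Cov(f, g)`
  have hlag : β ^ 2 * lagCov (boxState r.ρ β H) (fun U => softLoopObs r R (configShift (-(boxCentre H)) U)) R =
      ((r.N : ℝ) ^ 2)⁻¹ * ((∫ U, (∑ z ∈ timeZeroCube R, β * ((r.N : ℝ) -
          (r.ρ (walkHolonomy U (rectWalk (z + boxCentre H) 1 2 R R))).trace.re)) *
          (∑ z ∈ timeZeroCube R, β * ((r.N : ℝ) -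
            (r.ρ (walkHolonomy U (rectWalk (z + (boxCentre H + Pi.single 0 (R : ℤ))) 1 2 R R))).trace.re))
            ∂(boxState r.ρ β H)) -
        (∫ U, ∑ z ∈ timeZeroCube R, β * ((r.N : ℝ) -
            (r.ρ (walkHolonomy U (rectWalk (z + boxCentre H) 1 2 R R))).trace.re) ∂(boxState r.ρ β H)) *
          (∫ U, ∑ z ∈ timeZeroCube R, β * ((r.N : ℝ) -
            (r.ρ (walkHolonomy U (rectWalk (z + (boxCentre H + Pi.single 0 (R : ℤ))) 1 2 R R))).trace.re)
            ∂(boxState r.ρ β H))) := by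
    unfold lagCov
    simp_rw [softLoopObs_configShift_neg_timeShiftLG_eq_cost r R (boxCentre H) hβne,
      softLoopObs_configShift_neg_eq_cost r R (boxCentre H) hβne]
    rw [cov_const_sub_mul (boxState r.ρ β H) _ _ hfI hgI hfgI, ← mul_assoc]
    congr 1
    by_cases hN0 : (r.N : ℝ) = 0
    · rw [hN0]; simp
    · field_simp
  -- step 2: conditioning
  have hGdm : MeasurableSet (coldGoodSetG r.ρ H β ε) := measurableSet_coldGoodSetG r.ρ r.continuous β ε
  have hcond := abs_cov_sub_cov_cond_le (μ := boxState r.ρ β H) hGdm hG0 hfI hgI hfgI hfb hgb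
  -- step 3: the core
  have hcore := abs_loopCov_cond_sub_gauss_le_coreG r.ρ r.continuous r.injective r.mem_unitary (timeZeroCube R) (boxCentre H)
    (boxCentre H + Pi.single 0 (R : ℤ)) R hgm hβ hH hm0 hm4 hℓ hg hRw hRm hmE hmEm hwin hp hp1 hrep
  -- step 4: the Wick floor in Dirichlet dress
  have hδ0 : 0 ≤ K_D * (R : ℝ) ^ 4 / (H : ℝ) ^ 4 := by positivity
  have hDsum := wickLagSum_sub_le_sum_dirInductance_sq H R (boxCentre H) hδ0 (fun z hz z' hz' => by
    rw [← mutualInductance_shift _ _ (boxCentre H) R, add_right_comm z' _ (boxCentre H), add_assoc z' (boxCentre H)]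
    refine hKD _ _ (rectSurface_near_centre ?_) (rectSurface_near_centre ?_)
    · rw [add_sub_cancel_right]
      have := norm_le_of_mem_timeZeroCube hz
      linarith
    · rw [← add_assoc]
      have := norm_loopBase_sub_le hz' (boxCentre H) (le_refl R)
      linarith) hCM
  -- assemble
  have hD0 : (0 : ℝ) ≤ (dimE r.ρ : ℝ) / 2 := by positivity
  have hN2 : (0 : ℝ) ≤ ((r.N : ℝ) ^ 2)⁻¹ := by positivity
  rw [hlag]
  have h3 := (abs_le.1 hcond).1
  have h4 := (abs_le.1 hcore).1
  have h5 := mul_le_mul_of_nonneg_left hDsum hD0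
  rw [mul_sub] at h5
  have hB0 : (0 : ℝ) ≤ 6 * ((timeZeroCube R).card * (β * (2 * r.N))) * ((timeZeroCube R).card * (β * (2 * r.N))) := by positivity
  have hBq := mul_le_mul_of_nonneg_left hq hB0
  -- the linear combination, then multiply by `N⁻² ≥ 0`
  exact mul_le_mul_of_nonneg_left (by linarith [h3, h4, h5, hBq]) hN2

end Summit.QuantumFields.YangMills.Theorems.SoftLoopLongLag

end
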